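import Summits.KontsevichZagierPeriods.Zeta5Search.Certificates.RayC1CoeffAsymp
import Summits.KontsevichZagierPeriods.Zeta5Search.Certificates.RayC1Stirling
import Summits.KontsevichZagierPeriods.Zeta5Search.Certificates.RayC1DualFinalE0
import Summits.KontsevichZagierPeriods.Zeta5Search.Certificates.RayC1DualFinalE1
import Summits.KontsevichZagierPeriods.Zeta5Search.Certificates.RayC1GrowthUpper
import Summits.KontsevichZagierPeriods.Zeta5Search.Certificates.RecordRayExponent
import HarnessLib

/-!
# ζ(5) search — certificates: the ray RayC1 DECAYS — `|L_n| ≤ e^{(-69.1961+ε)n}` unconditionally, and its effective exponent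
(cell `pub-zeta5`, P1 g11; port of certifier 2's `Certificates/RecordRayDecay.lean` + `RecordRayExponent.record_exponent`)

HONEST FRAMING: systematic search; no irrationality claim unless certified. Nothing here is a statement about the arithmetic
nature of `ζ(5)`: an effective exponent `γ < 1` is a calibration of explicit approximations (Dirichlet gives `2` for free).

OUR work (Summit side). `L_n = ρ(a·n)·(W(b′)F̃₇(b) − W(b)F̃₇(b′)) = Q(a·n)ζ(5) − P_n` (`RayC1Forms.c1Form_eq`):
* `eventually_rho_termNorm_C1_le_exp` — `|ρ(a·n)|·Z_n ≤ e^{128·n·log n + (362.1468+ε)n}` (`RayC1Stirling`: `595.9961 -233.8493`),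
  and the same with the partner normaliser `Z(b′) = Z(b)(45n+1)(45n)`;
* `eventually_first/second_wedge_term_C1_le_exp` — both wedge terms `≤ e^{(-69.1961+ε)n}`: the `n log n` terms cancel
  (`128 − 128 + 0`), the rates add up to `362.1468 -166.05 -265.2929 = -69.1961` (census MODEL C₀ = -69.206);
* **`eventually_c1Form_le_exp`** — for every `ε > 0`, eventually `|L_n| ≤ e^{(-69.1961 + ε)·n}`;
* **`c1_exponent`** — given denominators `D_n` (`D_nP_n ∈ ℤ`, `0 < D_n ≤ e^{λn}` eventually; the cell's ladder, HYPOTHESIS here),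
  every `γ ≥ 0` with `γ(λ + 182.9376) < 182.9135 + 69.1961` is an effective exponent:
  eventually `|ζ(5) − P_n/Q(a·n)| < 1/q_n^γ`, `q_n = D_n|Q(a·n)|`, `p_n = D_nP_n ∈ ℤ`. The tie with Brown–Zudilin's `γ = 0.86597135`
  is at `λ* = 108.192` nats/step: ANY proved denominator rate below it on this ray beats the printed record exponent
  (instances `c1_exponent_rate_*`).
-/

noncomputable section

open Finset Real Filter Topology

namespace Summit.KontsevichZagierPeriods.Zeta5Search.RayC1

open Summit.KontsevichZagierPeriods.Zeta5Search.DualSeries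
open Summit.KontsevichZagierPeriods.Zeta5Search.DualSeriesBounds
open Summit.KontsevichZagierPeriods.Zeta5Search.WedgeDictionary
open Summit.KontsevichZagierPeriods.Zeta5Search.RecordRay (eventually_log_linear_le abs_sub_div_lt_of_bounds)
open Literature.NumberTheory.Transcendental (zetaValue)
open Literature.NumberTheory.Irrationality.BrownZudilin2022 (vwpDual)

/-- **Rate form of the Stirling bookkeeping**: for every `ε > 0`, eventually
`|ρ(a·n)|·Z(b) ≤ e^{128·n·log n + (362.1468 + ε)·n}` and the same for `Z(b′)`. -/
theorem eventually_rho_termNorm_C1_le_exp {ε : ℝ} (hε : 0 < ε) :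
    ∀ᶠ n : ℕ in atTop, |(rhoOf (aC1 n) : ℝ)| * termNorm (85 * n) (BC1E 0 n) ≤
        Real.exp (128 * n * Real.log n + (905367 / 2500 + ε) * n) ∧
      |(rhoOf (aC1 n) : ℝ)| * termNorm (85 * n) (BC1E 1 n) ≤
        Real.exp (128 * n * Real.log n + (905367 / 2500 + ε) * n) := by
  filter_upwards [eventually_ge_atTop 1,
    eventually_log_linear_le (a := 301) (b := 0) (by norm_num) le_rfl (show (0 : ℝ) < ε / 64 by positivity),
    eventually_log_linear_le (a := 600) (b := 0) (by norm_num) le_rfl (show (0 : ℝ) < ε / 16 by positivity),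
    eventually_log_linear_le (a := 46) (b := 0) (by norm_num) le_rfl (show (0 : ℝ) < ε / 16 by positivity),
    tendsto_natCast_atTop_atTop.eventually_ge_atTop (12 / ε)] with n hn hKR hKZ h46 hbig
  have hb : (12 : ℝ) ≤ ε * n := by rwa [div_le_iff₀ hε, mul_comm] at hbig
  rw [add_zero] at hKR hKZ h46
  have hnR : (1 : ℝ) ≤ n := by exact_mod_cast hn
  have hZ := termNorm_pos (85 * n) (BC1E 0 n)
  have hρ := log_abs_rhoOf_aC1_le hn
  have hZl := log_termNorm_C1_le hn
  have hpartner := termNorm_C1_partner hn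
  -- the partner factor `(45n+1)(45n) ≤ (46n)^2`
  have hfac : (45 * (n : ℝ) + 1) * (45 * n) ≤ Real.exp (2 * Real.log (46 * n)) := by
    rw [show (2 : ℝ) * Real.log (46 * n) = Real.log ((46 * n) ^ 2) by rw [Real.log_pow]; norm_num,
      Real.exp_log (by positivity)]
    nlinarith
  have hfac0 : (0 : ℝ) ≤ (45 * (n : ℝ) + 1) * (45 * n) := by positivity
  rcases (abs_nonneg (rhoOf (aC1 n) : ℝ)).eq_or_lt with h0 | hpos
  · rw [← h0, zero_mul, zero_mul]; exact ⟨(Real.exp_pos _).le, (Real.exp_pos _).le⟩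
  have h1 : |(rhoOf (aC1 n) : ℝ)| * termNorm (85 * n) (BC1E 0 n) ≤
      Real.exp (128 * n * Real.log n + (905367 / 2500 + ε / 2) * n) := by
    rw [← Real.exp_log hpos, ← Real.exp_log hZ, ← Real.exp_add]
    apply Real.exp_le_exp.2
    nlinarith
  constructor
  · refine h1.trans (Real.exp_le_exp.2 ?_); nlinarith
  · rw [hpartner, ← mul_assoc]
    calc |(rhoOf (aC1 n) : ℝ)| * termNorm (85 * n) (BC1E 0 n) * ((45 * (n : ℝ) + 1) * (45 * n))
        ≤ Real.exp (128 * n * Real.log n + (905367 / 2500 + ε / 2) * n) * Real.exp (2 * Real.log (46 * n)) :=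
          mul_le_mul h1 hfac hfac0 (Real.exp_pos _).le
      _ = Real.exp (128 * n * Real.log n + (905367 / 2500 + ε / 2) * n + 2 * Real.log (46 * n)) := by rw [← Real.exp_add]
      _ ≤ Real.exp (128 * n * Real.log n + (905367 / 2500 + ε) * n) := by apply Real.exp_le_exp.2; nlinarith

/-- **THE FIRST WEDGE TERM DECAYS AT RATE `-69.1961`**: for every `ε > 0`, eventually
`|ρ(a·n)|·|W(b′)|·F̃₇(b) ≤ e^{(-69.1961 + ε)·n}`. -/
theorem eventually_first_wedge_term_C1_le_exp {ε : ℝ} (hε : 0 < ε) :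
    ∀ᶠ n : ℕ in atTop, |(rhoOf (aC1 n) : ℝ)| * |(coeffW (bC1' n) : ℝ)| * vwpDual 7 (bC1 n) ≤
      Real.exp ((-691961 / 10000 + ε) * n) := by
  have hε3 : 0 < ε / 3 := by positivity
  filter_upwards [eventually_rho_termNorm_C1_le_exp hε3,
    eventually_coeffW_c1_le_exp hε3, eventually_vwpDual_c1E0_le_exp hε3] with n hρZ hW hF
  obtain ⟨hρZ0, -⟩ := hρZ
  obtain ⟨-, hW'⟩ := hW
  have hρ0 : 0 ≤ |(rhoOf (aC1 n) : ℝ)| := abs_nonneg _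
  have hW0 : 0 ≤ |(coeffW (bC1' n) : ℝ)| := abs_nonneg _
  have hFZ : vwpDual 7 (bC1 n) ≤ termNorm (85 * n) (BC1E 0 n) * Real.exp ((-2652929 / 10000 + ε / 3) * n) := hF
  calc |(rhoOf (aC1 n) : ℝ)| * |(coeffW (bC1' n) : ℝ)| * vwpDual 7 (bC1 n)
      ≤ |(rhoOf (aC1 n) : ℝ)| * |(coeffW (bC1' n) : ℝ)| *
          (termNorm (85 * n) (BC1E 0 n) * Real.exp ((-2652929 / 10000 + ε / 3) * n)) :=
        mul_le_mul_of_nonneg_left hFZ (mul_nonneg hρ0 hW0)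
    _ = (|(rhoOf (aC1 n) : ℝ)| * termNorm (85 * n) (BC1E 0 n)) * |(coeffW (bC1' n) : ℝ)| *
          Real.exp ((-2652929 / 10000 + ε / 3) * n) := by ring
    _ ≤ Real.exp (128 * n * Real.log n + (905367 / 2500 + ε / 3) * n) *
          Real.exp (-128 * n * Real.log n + (-(3321 / 20) + ε / 3) * n) *
          Real.exp ((-2652929 / 10000 + ε / 3) * n) := by
        apply mul_le_mul_of_nonneg_right _ (Real.exp_pos _).le
        exact mul_le_mul hρZ0 hW' hW0 (Real.exp_pos _).le
    _ = Real.exp ((-691961 / 10000 + ε) * n) := by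
        rw [← Real.exp_add, ← Real.exp_add]
        congr 1
        ring

/-- **THE SECOND WEDGE TERM DECAYS AT RATE `-69.1961`**: for every `ε > 0`, eventually
`|ρ(a·n)|·|W(b)|·F̃₇(b′) ≤ e^{(-69.1961 + ε)·n}`. -/
theorem eventually_second_wedge_term_C1_le_exp {ε : ℝ} (hε : 0 < ε) :
    ∀ᶠ n : ℕ in atTop, |(rhoOf (aC1 n) : ℝ)| * |(coeffW (bC1 n) : ℝ)| * vwpDual 7 (bC1' n) ≤
      Real.exp ((-691961 / 10000 + ε) * n) := by
  have hε3 : 0 < ε / 3 := by positivity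
  filter_upwards [eventually_rho_termNorm_C1_le_exp hε3,
    eventually_coeffW_c1_le_exp hε3, eventually_vwpDual_c1E1_le_exp hε3] with n hρZ hW hF
  obtain ⟨-, hρZ1⟩ := hρZ
  obtain ⟨hW', -⟩ := hW
  have hρ0 : 0 ≤ |(rhoOf (aC1 n) : ℝ)| := abs_nonneg _
  have hW0 : 0 ≤ |(coeffW (bC1 n) : ℝ)| := abs_nonneg _
  have hFZ : vwpDual 7 (bC1' n) ≤ termNorm (85 * n) (BC1E 1 n) * Real.exp ((-2652929 / 10000 + ε / 3) * n) := hF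
  calc |(rhoOf (aC1 n) : ℝ)| * |(coeffW (bC1 n) : ℝ)| * vwpDual 7 (bC1' n)
      ≤ |(rhoOf (aC1 n) : ℝ)| * |(coeffW (bC1 n) : ℝ)| *
          (termNorm (85 * n) (BC1E 1 n) * Real.exp ((-2652929 / 10000 + ε / 3) * n)) :=
        mul_le_mul_of_nonneg_left hFZ (mul_nonneg hρ0 hW0)
    _ = (|(rhoOf (aC1 n) : ℝ)| * termNorm (85 * n) (BC1E 1 n)) * |(coeffW (bC1 n) : ℝ)| *
          Real.exp ((-2652929 / 10000 + ε / 3) * n) := by ring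
    _ ≤ Real.exp (128 * n * Real.log n + (905367 / 2500 + ε / 3) * n) *
          Real.exp (-128 * n * Real.log n + (-(3321 / 20) + ε / 3) * n) *
          Real.exp ((-2652929 / 10000 + ε / 3) * n) := by
        apply mul_le_mul_of_nonneg_right _ (Real.exp_pos _).le
        exact mul_le_mul hρZ1 hW' hW0 (Real.exp_pos _).le
    _ = Real.exp ((-691961 / 10000 + ε) * n) := by
        rw [← Real.exp_add, ← Real.exp_add]
        congr 1
        ring

/-- **THE RAY DECAYS: `|L_n| ≤ e^{(-69.1961 + ε)·n}` eventually, for every `ε > 0`.** -/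
theorem eventually_c1Form_le_exp {ε : ℝ} (hε : 0 < ε) :
    ∀ᶠ n : ℕ in atTop, |c1Form n| ≤ Real.exp ((-691961 / 10000 + ε) * n) := by
  have hε2 : 0 < ε / 2 := by positivity
  filter_upwards [eventually_ge_atTop 1, eventually_first_wedge_term_C1_le_exp hε2,
    eventually_second_wedge_term_C1_le_exp hε2, tendsto_natCast_atTop_atTop.eventually_ge_atTop (2 / ε)]
    with n hn h1 h2 hbig
  have hb : (2 : ℝ) ≤ ε * n := by rwa [div_le_iff₀ hε, mul_comm] at hbig
  have hF0 : 0 ≤ vwpDual 7 (bC1 n) := (vwpDual_c1_pos n).le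
  have hF0' : 0 ≤ vwpDual 7 (bC1' n) :=
    (vwpDual_seven_pos (hle_c1E (e := 1) le_rfl hn) (hsum_c1E (e := 1) le_rfl)).le
  have habs : |c1Form n| ≤ |(rhoOf (aC1 n) : ℝ)| * |(coeffW (bC1' n) : ℝ)| * vwpDual 7 (bC1 n) +
      |(rhoOf (aC1 n) : ℝ)| * |(coeffW (bC1 n) : ℝ)| * vwpDual 7 (bC1' n) := by
    unfold c1Form
    rw [abs_mul]
    have h := abs_sub ((coeffW (bC1' n) : ℝ) * vwpDual 7 (bC1 n)) ((coeffW (bC1 n) : ℝ) * vwpDual 7 (bC1' n))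
    rw [abs_mul, abs_mul, abs_of_nonneg hF0, abs_of_nonneg hF0'] at h
    have hρ0 : 0 ≤ |(rhoOf (aC1 n) : ℝ)| := abs_nonneg _
    nlinarith
  have htwo : (2 : ℝ) * Real.exp ((-691961 / 10000 + ε / 2) * n) ≤ Real.exp ((-691961 / 10000 + ε) * n) := by
    have h2 : (2 : ℝ) ≤ Real.exp (ε / 2 * n) := by
      have := Real.add_one_le_exp (ε / 2 * n); nlinarith
    calc (2 : ℝ) * Real.exp ((-691961 / 10000 + ε / 2) * n)
        ≤ Real.exp (ε / 2 * n) * Real.exp ((-691961 / 10000 + ε / 2) * n) :=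
          mul_le_mul_of_nonneg_right h2 (Real.exp_pos _).le
      _ = Real.exp ((-691961 / 10000 + ε) * n) := by rw [← Real.exp_add]; congr 1; ring
  linarith

/-! ### The effective exponent -/

/-- **The ray's effective exponent.** PROVED here: the form identity, the growth `e^{(182.9135−ε)n} ≤ |Q(a·n)| ≤ e^{(182.9376+ε)n}`
and the decay `|L_n| ≤ e^{(-69.1961+ε)n}`. HYPOTHESIS (HD): denominators `D_n` with `D_nP_n ∈ ℤ`, `0 < D_n ≤ e^{λn}` eventually.
CONCLUSION: for every `γ ≥ 0` with `γ(λ + 182.9376) < 182.9135 + 69.1961`, eventually there are integers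
`p_n = D_nP_n`, `q_n = D_n|Q(a·n)| ≥ 1` with `|ζ(5) − P_n/Q(a·n)| < 1/q_n^γ`. -/
theorem c1_exponent {lam γ : ℝ} (D : ℕ → ℕ)
    (hD : ∀ᶠ n : ℕ in atTop, 0 < D n ∧ (∃ z : ℤ, (D n : ℚ) * c1P n = z) ∧ (D n : ℝ) ≤ Real.exp (lam * n))
    (hγ : 0 ≤ γ) (hrate : γ * (lam + 114336 / 625) < 365827 / 2000 - (-691961 / 10000)) :
    ∀ᶠ n : ℕ in atTop, ∃ p : ℤ, ∃ q : ℕ, 1 ≤ q ∧ (q : ℤ) = D n * |c1Q n| ∧ (p : ℚ) = D n * c1P n ∧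
      |zetaValue 5 - (c1P n : ℝ) / (c1Q n : ℝ)| < 1 / (q : ℝ) ^ γ := by
  obtain ⟨ε, hε, hrate'⟩ : ∃ ε : ℝ, 0 < ε ∧
      γ * (lam + (114336 / 625 + ε)) < (365827 / 2000 - ε) - ((-691961 / 10000) + ε) := by
    refine ⟨(365827 / 2000 - (-691961 / 10000) - γ * (lam + 114336 / 625)) / (2 * (γ + 2)), ?_, ?_⟩
    · apply div_pos (by linarith) (by positivity)
    · have hg1 : 0 < γ + 2 := by linarith
      field_simp
      nlinarith
  have hform : ∀ᶠ n : ℕ in atTop, |(c1Q n : ℝ) * zetaValue 5 - (c1P n : ℝ)| ≤ Real.exp (((-691961 / 10000) + ε) * n) := by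
    filter_upwards [eventually_c1Form_le_exp hε, eventually_ge_atTop 1] with n hn hn1
    rwa [c1Form_eq hn1] at hn
  have hD' : ∀ᶠ n : ℕ in atTop, 0 < (D n : ℝ) ∧ (D n : ℝ) ≤ Real.exp (lam * n) := by
    filter_upwards [hD] with n hn; exact ⟨by exact_mod_cast hn.1, hn.2.2⟩
  have key := abs_sub_div_lt_of_bounds (ξ := zetaValue 5) (Q := fun n => (c1Q n : ℝ)) (P := fun n => (c1P n : ℝ))
    (D := fun n => (D n : ℝ)) hform (eventually_exp_le_abs_c1Q hε) (eventually_abs_c1Q_le_exp hε) hD' hγ hrate'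
  filter_upwards [key, hD] with n hn hDn
  obtain ⟨hDpos, ⟨z, hz⟩, -⟩ := hDn
  refine ⟨z, D n * (c1Q n).natAbs, ?_, ?_, hz.symm, ?_⟩
  · have hQ : c1Q n ≠ 0 := by
      have := (latticeTerm_le_abs_c1Q n).2
      intro h; rw [h] at this; simp at this
    exact Nat.one_le_iff_ne_zero.mpr (Nat.mul_ne_zero hDpos.ne' (Int.natAbs_ne_zero.mpr hQ))
  · simp
  · have hcast : ((D n * (c1Q n).natAbs : ℕ) : ℝ) = (D n : ℝ) * |(c1Q n : ℝ)| := by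
      push_cast; rw [Nat.cast_natAbs, Int.cast_abs]
    rw [hcast]
    exact hn

/-- With the CERTIFIED rates of this chain and a denominator rate `λ = 106.862` (plus32), every `γ ≤ 0.8699` satisfies
the rate condition of `c1_exponent` (supremum `0.86994`; Brown–Zudilin's record worthiness is `0.86597135`). -/
theorem c1_exponent_rate_plus32 {γ : ℝ} (hγ : γ ≤ 8699 / 10000) :
    γ * (53431 / 500 + 114336 / 625) < 365827 / 2000 - ((-691961 / 10000 : ℝ)) := by
  nlinarith

/-- With the CERTIFIED rates of this chain and a denominator rate `λ = 107.727` (lettersZ21O20), every `γ ≤ 0.8673` satisfies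
the rate condition of `c1_exponent` (supremum `0.86736`; Brown–Zudilin's record worthiness is `0.86597135`). -/
theorem c1_exponent_rate_lettersZ21O20 {γ : ℝ} (hγ : γ ≤ 8673 / 10000) :
    γ * (107727 / 1000 + 114336 / 625) < 365827 / 2000 - ((-691961 / 10000 : ℝ)) := by
  nlinarith

/-- With the CERTIFIED rates of this chain and a denominator rate `λ = 109.727` (letters), every `γ ≤ 0.8614` satisfies
the rate condition of `c1_exponent` (supremum `0.86143`; Brown–Zudilin's record worthiness is `0.86597135`). -/
theorem c1_exponent_rate_letters {γ : ℝ} (hγ : γ ≤ 4307 / 5000) :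
    γ * (109727 / 1000 + 114336 / 625) < 365827 / 2000 - ((-691961 / 10000 : ℝ)) := by
  nlinarith

end Summit.KontsevichZagierPeriods.Zeta5Search.RayC1
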